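import Summits.NavierStokesRegularity.NavierStokesRegularity.Theorems.TypeILiouvilleTypeIliouvilleNoTypeIITypeIIZoomPackage
import Literature.Analysis.FluidPDE.LocalTypeI
import HarnessLib

/-!
# Fatou along the Type-II zoom package: integral functionals pass to the eternal limit
# (crux `TypeIliouvilleNoTypeII`, stmt-NavierStokesRegularity-0056; D-0081 §B TRANSFER tool)

Helper file (theorems only).  The Type-II zoom package
(`TypeIIZoom.exists_typeIIZoomPackage`, file `…TypeIIZoomPackage.lean`) exports, for a maximal
Leray–Hopf solution `(u, p)` from a rapidly decaying datum which is NOT Type I at `T`, the zooms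
`w_j = M_j⁻¹ • stPull (ν/M_j²) (ν/M_j) t_j x_j u` on the rescaled windows `(-j, j) × ℝ³` and their
pointwise-with-gradients limit `v`, a bounded eternal Oseen-mild smooth field.  A candidate a-priori
estimate `E` of the Type-II-exclusion programme is TRANSFERRED to `v` in two moves: a scaling
identity (candidate-specific; for the Caffarelli–Kohn–Nirenberg / Albritton–Barker quantities the
tree has `Literature.Analysis.FluidPDE.cknC_nsZoom`, `cknE_nsZoom`, `cknAEss_nsZoom`, `typeIBound_nsZoom`) and a
lower-semicontinuity step along the package sequence.  This file lands the second move once, for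
every nonnegative continuous integrand of the velocity or of its gradient on any bounded-in-time
measurable space–time set:

* `setLIntegral_le_liminf_of_tendsto` — Fatou for an EVENTUALLY a.e.-measurable sequence
  converging pointwise on the set (pure measure theory; the zooms are only defined, let alone
  continuous, on the windows `(-j, j) × ℝ³`, so measurability holds for `j` large only);
* `setLIntegral_zoomLimit_le_liminf` — `∫_S Φ(v) ≤ liminf_j ∫_S Φ(w_j)` for continuous
  `Φ : ℝ³ → [0, ∞]` and measurable `S ⊆ (-S₀, S₀) × ℝ³`;
* `setLIntegral_fderiv_zoomLimit_le_liminf` — the same for `Ψ(∇v)`, `Ψ : (ℝ³ →L ℝ³) → [0, ∞]`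
  continuous (the zooms are jointly smooth on their windows, `windowZoom_isClassical`);
* `cknC_zoomLimit_le`, `cknE_zoomLimit_le` — instances: an eventual bound `K` on the scaled local
  cubic integral `C(w_j; Q_r(z)) = r⁻² ∫∫_{Q_r(z)} |w_j|³`, resp. on the scaled local dissipation
  `E(∇w_j; Q_r(z)) = r⁻¹ ∫∫_{Q_r(z)} |∇w_j|²`, passes to the limit: `C(v; Q_r(z)) ≤ K`,
  `E(∇v; Q_r(z)) ≤ K` (Albritton–Barker 2019 §1 quantities, tree `cknC` / `cknE`);
* `setLIntegral_slice_zoomLimit_le_liminf`, `cknA_zoomLimit_le`, `cknAEss_zoomLimit_le` — the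
  same for SLICE integrals at a fixed time and for the scaled local energy
  `A(w; Q_r(z)) = sup_t r⁻¹ ∫_{B_r} |w(t)|²` in both its `sup` (tree `cknA`) and `ess sup` (tree
  `cknAEss`, the one entering `abScaledSum` / `typeIBound`) forms (`essSup ∘ liminf ≤ liminf ∘ essSup`).

What is NOT here: no scaling identity (tree, candidate-specific), no pressure quantity (`cknDOsc`:
the package carries no pressure), no Liouville theorem.
-/

noncomputable section

-- the summit and its single problem share the name `NavierStokesRegularity` (D-0017 nested layout)
set_option linter.dupNamespace false

open Set Function Filter Topology MeasureTheory Metric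
open scoped NNReal ENNReal

namespace Summit.NavierStokesRegularity.NavierStokesRegularity.Theorems.TypeIliouvilleNoTypeII.TypeIIZoom

open Literature.Analysis Literature.Analysis.FluidPDE
open Summit.NavierStokesRegularity.NavierStokesRegularity.Theorems.TypeIliouvilleNoTypeII.ImmortalZoom

/-! ## Fatou along an eventually measurable, pointwise convergent sequence -/

/-- **Fatou's lemma on a set, for an eventually a.e.-measurable sequence converging pointwise on
the set**: `∫_S f ≤ liminf_j ∫_S F_j` if `F_j → f` at every point of the measurable set `S` and
`F_j` is a.e.-measurable on `S` for all large `j`. [folklore] -/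
theorem setLIntegral_le_liminf_of_tendsto {α : Type*} [MeasurableSpace α] {μ : Measure α}
    {S : Set α} (hS : MeasurableSet S) {F : ℕ → α → ℝ≥0∞} {f : α → ℝ≥0∞}
    (hmeas : ∀ᶠ j in atTop, AEMeasurable (F j) (μ.restrict S))
    (hlim : ∀ q ∈ S, Tendsto (fun j => F j q) atTop (𝓝 (f q))) :
    ∫⁻ q in S, f q ∂μ ≤ liminf (fun j => ∫⁻ q in S, F j q ∂μ) atTop := by
  obtain ⟨j₀, hj₀⟩ := eventually_atTop.1 hmeas
  have hG : ∀ n, AEMeasurable (F (n + j₀)) (μ.restrict S) := fun n => hj₀ _ (Nat.le_add_left _ _)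
  rw [← Filter.liminf_nat_add (fun j => ∫⁻ q in S, F j q ∂μ) j₀]
  refine le_trans (lintegral_mono_ae ?_) (lintegral_liminf_le' hG)
  filter_upwards [ae_restrict_mem hS] with q hq
  exact (((hlim q hq).comp (tendsto_add_atTop_nat j₀)).liminf_eq).ge

/-- An eventual bound passes through Fatou: if `∫_S f ≤ liminf ∫_S F_j` and `∫_S F_j ≤ K`
eventually, then `∫_S f ≤ K`. [folklore] -/
theorem le_of_le_liminf_of_eventually_le {g : ℕ → ℝ≥0∞} {a K : ℝ≥0∞}
    (ha : a ≤ liminf g atTop) (hK : ∀ᶠ j in atTop, g j ≤ K) : a ≤ K :=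
  ha.trans (liminf_le_of_frequently_le' hK.frequently)

/-! ## The zooms are continuous, with continuous gradients, on their windows -/

variable {ν T : ℝ} {u : ℝ → EuclideanSpace ℝ (Fin 3) → EuclideanSpace ℝ (Fin 3)}
  {p : ℝ → EuclideanSpace ℝ (Fin 3) → ℝ} {tc M : ℕ → ℝ} {xc : ℕ → EuclideanSpace ℝ (Fin 3)}
  {v : ℝ → EuclideanSpace ℝ (Fin 3) → EuclideanSpace ℝ (Fin 3)}

/-- The windows of the package lie in `(0, T)` (they lie in the final slabs `(T - T/(j+1), T)`).
[folklore] -/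
theorem window_subset_Ioo (hT : 0 < T)
    (hsub : ∀ j : ℕ,
      Icc (tc j - j * ν / M j ^ 2) (tc j + j * ν / M j ^ 2) ⊆ Ioo (T - T / (j + 1)) T)
    (j : ℕ) : Icc (tc j - j * ν / M j ^ 2) (tc j + j * ν / M j ^ 2) ⊆ Ioo 0 T := by
  refine (hsub j).trans (Ioo_subset_Ioo_left ?_)
  have h1 : T / (j + 1) ≤ T := div_le_self hT.le (le_add_of_nonneg_left (Nat.cast_nonneg j))
  linarith

/-- A bounded-in-time set `S ⊆ (-S₀, S₀) × ℝ³` lies in the rescaled window `(-j, j) × ℝ³` for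
`j ≥ ⌈S₀⌉₊`. [folklore] -/
theorem subset_window_of_ceil_le {S : Set (ℝ × EuclideanSpace ℝ (Fin 3))} {S₀ : ℝ}
    (hSsub : S ⊆ Ioo (-S₀) S₀ ×ˢ univ) {j : ℕ} (hj : ⌈S₀⌉₊ ≤ j) :
    S ⊆ Ioo (-(j : ℝ)) j ×ˢ univ := by
  have hS₀ : S₀ ≤ j := Nat.ceil_le.1 hj
  exact hSsub.trans (prod_mono (Ioo_subset_Ioo (by linarith) hS₀) Subset.rfl)

/-- **Eventual measurability of a continuous functional of the zooms** on a bounded-in-time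
measurable set: `q ↦ Φ(w_j(q))` is a.e.-measurable on `S ⊆ (-S₀, S₀) × ℝ³` for `j ≥ ⌈S₀⌉₊`
(the zoom `w_j` is jointly continuous on `(-j, j) × ℝ³`, `windowZoom_continuousOn`). [folklore] -/
theorem eventually_aemeasurable_comp_zoom (hν : 0 < ν) (hT : 0 < T)
    (hsol : IsClassicalNSSolutionOn (Ico 0 T) ν 0 u p) (hM : ∀ j, 0 < M j)
    (hsub : ∀ j : ℕ,
      Icc (tc j - j * ν / M j ^ 2) (tc j + j * ν / M j ^ 2) ⊆ Ioo (T - T / (j + 1)) T)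
    {Φ : EuclideanSpace ℝ (Fin 3) → ℝ≥0∞} (hΦ : Continuous Φ)
    {S : Set (ℝ × EuclideanSpace ℝ (Fin 3))} (hS : MeasurableSet S) {S₀ : ℝ}
    (hSsub : S ⊆ Ioo (-S₀) S₀ ×ˢ univ) :
    ∀ᶠ j : ℕ in atTop, AEMeasurable
      (fun q : ℝ × EuclideanSpace ℝ (Fin 3) =>
        Φ (((M j)⁻¹ • stPull (ν / M j ^ 2) (ν / M j) (tc j) (xc j) u) q.1 q.2))
      (volume.restrict S) := by
  filter_upwards [eventually_ge_atTop ⌈S₀⌉₊] with j hj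
  have hc : ContinuousOn (uncurry ((M j)⁻¹ • stPull (ν / M j ^ 2) (ν / M j) (tc j) (xc j) u))
      (Ioo (-(j : ℝ)) j ×ˢ univ) :=
    windowZoom_continuousOn hν hsol (hM j) (window_subset_Ioo hT hsub j)
  exact (hΦ.comp_continuousOn (hc.mono (subset_window_of_ceil_le hSsub hj))).aemeasurable hS

/-- **Eventual measurability of a continuous functional of the zooms' gradients** on a
bounded-in-time measurable set (the zooms are jointly smooth on their windows,
`windowZoom_isClassical`, so `(s, y) ↦ ∇w_j(s)(y)` is jointly continuous there). [folklore] -/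
theorem eventually_aemeasurable_comp_fderiv_zoom (hν : 0 < ν) (hT : 0 < T)
    (hsol : IsClassicalNSSolutionOn (Ico 0 T) ν 0 u p) (hM : ∀ j, 0 < M j)
    (hsub : ∀ j : ℕ,
      Icc (tc j - j * ν / M j ^ 2) (tc j + j * ν / M j ^ 2) ⊆ Ioo (T - T / (j + 1)) T)
    {Ψ : (EuclideanSpace ℝ (Fin 3) →L[ℝ] EuclideanSpace ℝ (Fin 3)) → ℝ≥0∞} (hΨ : Continuous Ψ)
    {S : Set (ℝ × EuclideanSpace ℝ (Fin 3))} (hS : MeasurableSet S) {S₀ : ℝ}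
    (hSsub : S ⊆ Ioo (-S₀) S₀ ×ˢ univ) :
    ∀ᶠ j : ℕ in atTop, AEMeasurable
      (fun q : ℝ × EuclideanSpace ℝ (Fin 3) =>
        Ψ (fderiv ℝ (((M j)⁻¹ • stPull (ν / M j ^ 2) (ν / M j) (tc j) (xc j) u) q.1) q.2))
      (volume.restrict S) := by
  filter_upwards [eventually_ge_atTop ⌈S₀⌉₊] with j hj
  have hcl := windowZoom_isClassical (x₀ := xc j) hν hsol (hM j) (window_subset_Ioo hT hsub j)
  have hc : ContinuousOn
      (fun q : ℝ × EuclideanSpace ℝ (Fin 3) =>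
        fderiv ℝ (((M j)⁻¹ • stPull (ν / M j ^ 2) (ν / M j) (tc j) (xc j) u) q.1) q.2)
      (Ioo (-(j : ℝ)) j ×ˢ univ) :=
    hcl.smooth_velocity.continuousOn_fderiv_slice isOpen_Ioo.uniqueDiffOn
  exact (hΨ.comp_continuousOn (hc.mono (subset_window_of_ceil_le hSsub hj))).aemeasurable hS

/-! ## Integral functionals of the velocity and of the gradient pass to the limit -/

/-- **Velocity functionals pass to the Type-II zoom limit.**  Along the package sequence
(`w_j → v` at every point), for every continuous `Φ : ℝ³ → [0, ∞]` and every measurable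
bounded-in-time `S ⊆ (-S₀, S₀) × ℝ³`: `∫_S Φ(v) ≤ liminf_j ∫_S Φ(w_j)`. [folklore] -/
theorem setLIntegral_zoomLimit_le_liminf (hν : 0 < ν) (hT : 0 < T)
    (hsol : IsClassicalNSSolutionOn (Ico 0 T) ν 0 u p) (hM : ∀ j, 0 < M j)
    (hsub : ∀ j : ℕ,
      Icc (tc j - j * ν / M j ^ 2) (tc j + j * ν / M j ^ 2) ⊆ Ioo (T - T / (j + 1)) T)
    (hval : ∀ s y, Tendsto
      (fun j => ((M j)⁻¹ • stPull (ν / M j ^ 2) (ν / M j) (tc j) (xc j) u) s y) atTop (𝓝 (v s y)))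
    {Φ : EuclideanSpace ℝ (Fin 3) → ℝ≥0∞} (hΦ : Continuous Φ)
    {S : Set (ℝ × EuclideanSpace ℝ (Fin 3))} (hS : MeasurableSet S) {S₀ : ℝ}
    (hSsub : S ⊆ Ioo (-S₀) S₀ ×ˢ univ) :
    ∫⁻ q in S, Φ (v q.1 q.2) ≤
      liminf (fun j => ∫⁻ q in S,
        Φ (((M j)⁻¹ • stPull (ν / M j ^ 2) (ν / M j) (tc j) (xc j) u) q.1 q.2)) atTop :=
  setLIntegral_le_liminf_of_tendsto hS
    (eventually_aemeasurable_comp_zoom hν hT hsol hM hsub hΦ hS hSsub)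
    fun q _ => (hΦ.tendsto _).comp (hval q.1 q.2)

/-- **Gradient functionals pass to the Type-II zoom limit.**  Along the package sequence
(`∇w_j → ∇v` at every point), for every continuous `Ψ : (ℝ³ →L ℝ³) → [0, ∞]` and every
measurable bounded-in-time `S ⊆ (-S₀, S₀) × ℝ³`: `∫_S Ψ(∇v) ≤ liminf_j ∫_S Ψ(∇w_j)`. [folklore] -/
theorem setLIntegral_fderiv_zoomLimit_le_liminf (hν : 0 < ν) (hT : 0 < T)
    (hsol : IsClassicalNSSolutionOn (Ico 0 T) ν 0 u p) (hM : ∀ j, 0 < M j)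
    (hsub : ∀ j : ℕ,
      Icc (tc j - j * ν / M j ^ 2) (tc j + j * ν / M j ^ 2) ⊆ Ioo (T - T / (j + 1)) T)
    (hgrad : ∀ s y, Tendsto
      (fun j => fderiv ℝ (((M j)⁻¹ • stPull (ν / M j ^ 2) (ν / M j) (tc j) (xc j) u) s) y)
      atTop (𝓝 (fderiv ℝ (v s) y)))
    {Ψ : (EuclideanSpace ℝ (Fin 3) →L[ℝ] EuclideanSpace ℝ (Fin 3)) → ℝ≥0∞} (hΨ : Continuous Ψ)
    {S : Set (ℝ × EuclideanSpace ℝ (Fin 3))} (hS : MeasurableSet S) {S₀ : ℝ}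
    (hSsub : S ⊆ Ioo (-S₀) S₀ ×ˢ univ) :
    ∫⁻ q in S, Ψ (fderiv ℝ (v q.1) q.2) ≤
      liminf (fun j => ∫⁻ q in S,
        Ψ (fderiv ℝ (((M j)⁻¹ • stPull (ν / M j ^ 2) (ν / M j) (tc j) (xc j) u) q.1) q.2)) atTop :=
  setLIntegral_le_liminf_of_tendsto hS
    (eventually_aemeasurable_comp_fderiv_zoom hν hT hsol hM hsub hΨ hS hSsub)
    fun q _ => (hΨ.tendsto _).comp (hgrad q.1 q.2)

/-! ## Instances: the Albritton–Barker / CKN local quantities `C` and `E` -/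

/-- A parabolic cylinder is a bounded-in-time measurable set: `Q_r(z) ⊆ (-S₀, S₀) × ℝ³` with
`S₀ = |z.1| + r² + 1`. [folklore] -/
theorem parabolicCylinder_subset_slab (r : ℝ) (z : ℝ × EuclideanSpace ℝ (Fin 3)) :
    parabolicCylinder r z ⊆ Ioo (-(|z.1| + r ^ 2 + 1)) (|z.1| + r ^ 2 + 1) ×ˢ univ := by
  rintro ⟨s, y⟩ hq
  rw [mem_parabolicCylinder] at hq
  refine ⟨⟨?_, ?_⟩, mem_univ _⟩
  · have := neg_abs_le z.1
    linarith [hq.1.1, sq_nonneg r]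
  · have := le_abs_self z.1
    linarith [hq.1.2, sq_nonneg r]

/-- **The scaled local cubic integral passes to the Type-II zoom limit**: if
`C(w_j; Q_r(z)) ≤ K` for all large `j`, then `C(v; Q_r(z)) ≤ K` (`cknC r z u = r⁻² ∫∫_{Q_r(z)} |u|³`,
Albritton–Barker 2019 §1). [cite: AlbrittonBarker2019, §1 (the quantity C)] -/
theorem cknC_zoomLimit_le (hν : 0 < ν) (hT : 0 < T)
    (hsol : IsClassicalNSSolutionOn (Ico 0 T) ν 0 u p) (hM : ∀ j, 0 < M j)
    (hsub : ∀ j : ℕ,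
      Icc (tc j - j * ν / M j ^ 2) (tc j + j * ν / M j ^ 2) ⊆ Ioo (T - T / (j + 1)) T)
    (hval : ∀ s y, Tendsto
      (fun j => ((M j)⁻¹ • stPull (ν / M j ^ 2) (ν / M j) (tc j) (xc j) u) s y) atTop (𝓝 (v s y)))
    {r : ℝ} {z : ℝ × EuclideanSpace ℝ (Fin 3)} {K : ℝ≥0∞}
    (hK : ∀ᶠ j : ℕ in atTop,
      cknC r z ((M j)⁻¹ • stPull (ν / M j ^ 2) (ν / M j) (tc j) (xc j) u) ≤ K) :
    cknC r z v ≤ K := by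
  rcases le_or_gt r 0 with hr | hr
  · simp [cknC, parabolicCylinder_eq_empty hr]
  have hc : (ENNReal.ofReal r ^ 2)⁻¹ ≠ ⊤ :=
    ENNReal.inv_ne_top.2 (pow_ne_zero 2 (by simpa using hr))
  have hΦ : Continuous fun x : EuclideanSpace ℝ (Fin 3) => ‖x‖ₑ ^ (3 : ℕ) :=
    (ENNReal.continuous_pow 3).comp continuous_enorm
  have hF := setLIntegral_zoomLimit_le_liminf hν hT hsol hM hsub hval hΦ
    (isOpen_parabolicCylinder r z).measurableSet (parabolicCylinder_subset_slab r z)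
  refine le_of_le_liminf_of_eventually_le ?_ hK
  unfold cknC
  rw [ENNReal.liminf_const_mul_of_ne_top hc]
  exact mul_le_mul' le_rfl hF

/-- **The scaled local dissipation passes to the Type-II zoom limit**: if `E(∇w_j; Q_r(z)) ≤ K`
for all large `j`, then `E(∇v; Q_r(z)) ≤ K` (`cknE r z G = r⁻¹ ∫∫_{Q_r(z)} |G|²_F` with
`G = ∇v`, Albritton–Barker 2019 §1). [cite: AlbrittonBarker2019, §1 (the quantity E)] -/
theorem cknE_zoomLimit_le (hν : 0 < ν) (hT : 0 < T)
    (hsol : IsClassicalNSSolutionOn (Ico 0 T) ν 0 u p) (hM : ∀ j, 0 < M j)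
    (hsub : ∀ j : ℕ,
      Icc (tc j - j * ν / M j ^ 2) (tc j + j * ν / M j ^ 2) ⊆ Ioo (T - T / (j + 1)) T)
    (hgrad : ∀ s y, Tendsto
      (fun j => fderiv ℝ (((M j)⁻¹ • stPull (ν / M j ^ 2) (ν / M j) (tc j) (xc j) u) s) y)
      atTop (𝓝 (fderiv ℝ (v s) y)))
    {r : ℝ} {z : ℝ × EuclideanSpace ℝ (Fin 3)} {K : ℝ≥0∞}
    (hK : ∀ᶠ j : ℕ in atTop,
      cknE r z (fun s y =>
        fderiv ℝ (((M j)⁻¹ • stPull (ν / M j ^ 2) (ν / M j) (tc j) (xc j) u) s) y) ≤ K) :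
    cknE r z (fun s y => fderiv ℝ (v s) y) ≤ K := by
  rcases le_or_gt r 0 with hr | hr
  · simp [cknE, parabolicCylinder_eq_empty hr]
  have hc : (ENNReal.ofReal r)⁻¹ ≠ ⊤ := ENNReal.inv_ne_top.2 (by simpa using hr)
  have hΨ : Continuous fun L : EuclideanSpace ℝ (Fin 3) →L[ℝ] EuclideanSpace ℝ (Fin 3) =>
      ENNReal.ofReal (frobeniusNormSq L) :=
    ENNReal.continuous_ofReal.comp LerayHopfProofs.continuous_frobeniusNormSq
  have hF := setLIntegral_fderiv_zoomLimit_le_liminf hν hT hsol hM hsub hgrad hΨ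
    (isOpen_parabolicCylinder r z).measurableSet (parabolicCylinder_subset_slab r z)
  refine le_of_le_liminf_of_eventually_le ?_ hK
  unfold cknE
  rw [ENNReal.liminf_const_mul_of_ne_top hc]
  exact mul_le_mul' le_rfl hF

/-! ## Slice functionals: the scaled local energies `A` (`sup` and `ess sup` forms) -/

/-- **Eventual measurability of a continuous functional of a zoom SLICE** `y ↦ Φ(w_j(t, y))` on a
measurable set of `ℝ³`, for `j > |t|`. [folklore] -/
theorem eventually_aemeasurable_comp_zoom_slice (hν : 0 < ν) (hT : 0 < T)
    (hsol : IsClassicalNSSolutionOn (Ico 0 T) ν 0 u p) (hM : ∀ j, 0 < M j)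
    (hsub : ∀ j : ℕ,
      Icc (tc j - j * ν / M j ^ 2) (tc j + j * ν / M j ^ 2) ⊆ Ioo (T - T / (j + 1)) T)
    {Φ : EuclideanSpace ℝ (Fin 3) → ℝ≥0∞} (hΦ : Continuous Φ)
    (B : Set (EuclideanSpace ℝ (Fin 3))) (t : ℝ) :
    ∀ᶠ j : ℕ in atTop, AEMeasurable
      (fun y : EuclideanSpace ℝ (Fin 3) =>
        Φ (((M j)⁻¹ • stPull (ν / M j ^ 2) (ν / M j) (tc j) (xc j) u) t y))
      (volume.restrict B) := by
  filter_upwards [eventually_ge_atTop ⌈|t| + 1⌉₊] with j hj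
  have ht : t ∈ Ioo (-(j : ℝ)) j := by
    have h1 : |t| + 1 ≤ j := Nat.ceil_le.1 hj
    exact ⟨by linarith [neg_abs_le t], by linarith [le_abs_self t]⟩
  have hc : ContinuousOn (uncurry ((M j)⁻¹ • stPull (ν / M j ^ 2) (ν / M j) (tc j) (xc j) u))
      (Ioo (-(j : ℝ)) j ×ˢ univ) :=
    windowZoom_continuousOn hν hsol (hM j) (window_subset_Ioo hT hsub j)
  have hslice : Continuous fun y : EuclideanSpace ℝ (Fin 3) =>
      ((M j)⁻¹ • stPull (ν / M j ^ 2) (ν / M j) (tc j) (xc j) u) t y := by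
    have h := hc.comp_continuous (continuous_const.prodMk continuous_id)
      (fun y => ⟨ht, mem_univ y⟩)
    simpa [Function.comp_def] using h
  exact (hΦ.comp hslice).aemeasurable

/-- **Slice integrals pass to the Type-II zoom limit**: for each time `t`, continuous
`Φ : ℝ³ → [0, ∞]` and measurable `B ⊆ ℝ³`, `∫_B Φ(v(t)) ≤ liminf_j ∫_B Φ(w_j(t))`. [folklore] -/
theorem setLIntegral_slice_zoomLimit_le_liminf (hν : 0 < ν) (hT : 0 < T)
    (hsol : IsClassicalNSSolutionOn (Ico 0 T) ν 0 u p) (hM : ∀ j, 0 < M j)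
    (hsub : ∀ j : ℕ,
      Icc (tc j - j * ν / M j ^ 2) (tc j + j * ν / M j ^ 2) ⊆ Ioo (T - T / (j + 1)) T)
    (hval : ∀ s y, Tendsto
      (fun j => ((M j)⁻¹ • stPull (ν / M j ^ 2) (ν / M j) (tc j) (xc j) u) s y) atTop (𝓝 (v s y)))
    {Φ : EuclideanSpace ℝ (Fin 3) → ℝ≥0∞} (hΦ : Continuous Φ)
    {B : Set (EuclideanSpace ℝ (Fin 3))} (hB : MeasurableSet B) (t : ℝ) :
    ∫⁻ y in B, Φ (v t y) ≤
      liminf (fun j => ∫⁻ y in B,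
        Φ (((M j)⁻¹ • stPull (ν / M j ^ 2) (ν / M j) (tc j) (xc j) u) t y)) atTop :=
  setLIntegral_le_liminf_of_tendsto hB
    (eventually_aemeasurable_comp_zoom_slice hν hT hsol hM hsub hΦ B t)
    fun y _ => (hΦ.tendsto _).comp (hval t y)

/-- **The scaled local energy (`sup` form) passes to the Type-II zoom limit**: if
`A(w_j; Q_r(z)) ≤ K` for all large `j`, then `A(v; Q_r(z)) ≤ K`
(`cknA r z u = sup_{t ∈ (t₀ - r², t₀)} r⁻¹ ∫_{B_r(x₀)} |u(t)|²`, CKN 1982 / Albritton–Barker 2019 §1).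
[cite: AlbrittonBarker2019, §1 (the quantity A)] -/
theorem cknA_zoomLimit_le (hν : 0 < ν) (hT : 0 < T)
    (hsol : IsClassicalNSSolutionOn (Ico 0 T) ν 0 u p) (hM : ∀ j, 0 < M j)
    (hsub : ∀ j : ℕ,
      Icc (tc j - j * ν / M j ^ 2) (tc j + j * ν / M j ^ 2) ⊆ Ioo (T - T / (j + 1)) T)
    (hval : ∀ s y, Tendsto
      (fun j => ((M j)⁻¹ • stPull (ν / M j ^ 2) (ν / M j) (tc j) (xc j) u) s y) atTop (𝓝 (v s y)))
    {r : ℝ} {z : ℝ × EuclideanSpace ℝ (Fin 3)} {K : ℝ≥0∞}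
    (hK : ∀ᶠ j : ℕ in atTop,
      cknA r z ((M j)⁻¹ • stPull (ν / M j ^ 2) (ν / M j) (tc j) (xc j) u) ≤ K) :
    cknA r z v ≤ K := by
  unfold cknA
  refine iSup₂_le fun t ht => ?_
  rcases le_or_gt r 0 with hr | hr
  · simp [Metric.ball_eq_empty.2 hr]
  have hc : (ENNReal.ofReal r)⁻¹ ≠ ⊤ := ENNReal.inv_ne_top.2 (by simpa using hr)
  have hΦ : Continuous fun x : EuclideanSpace ℝ (Fin 3) => ‖x‖ₑ ^ (2 : ℕ) :=
    (ENNReal.continuous_pow 2).comp continuous_enorm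
  have hF := setLIntegral_slice_zoomLimit_le_liminf hν hT hsol hM hsub hval hΦ measurableSet_ball t
    (B := ball z.2 r)
  have hK' : ∀ᶠ j : ℕ in atTop, (ENNReal.ofReal r)⁻¹ * ∫⁻ y in ball z.2 r,
      ‖((M j)⁻¹ • stPull (ν / M j ^ 2) (ν / M j) (tc j) (xc j) u) t y‖ₑ ^ (2 : ℕ) ≤ K := by
    filter_upwards [hK] with j hj
    refine le_trans ?_ hj
    unfold cknA
    exact le_iSup₂ (f := fun s (_ : s ∈ Ioo (z.1 - r ^ 2) z.1) =>
      (ENNReal.ofReal r)⁻¹ * ∫⁻ y in ball z.2 r,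
        ‖((M j)⁻¹ • stPull (ν / M j ^ 2) (ν / M j) (tc j) (xc j) u) s y‖ₑ ^ (2 : ℕ)) t ht
  refine le_of_le_liminf_of_eventually_le ?_ hK'
  rw [ENNReal.liminf_const_mul_of_ne_top hc]
  exact mul_le_mul' le_rfl hF

/-- **The scaled local energy (`ess sup` form) passes to the Type-II zoom limit**: if
`A_ess(w_j; Q_r(z)) ≤ K` for all large `j`, then `A_ess(v; Q_r(z)) ≤ K` (`cknAEss`, the `A` entering
Albritton–Barker's `𝐈` in the tree's `abScaledSum`; via `essSup (liminf) ≤ liminf (essSup)`).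
[cite: AlbrittonBarker2019, §1 (the quantity A)] -/
theorem cknAEss_zoomLimit_le (hν : 0 < ν) (hT : 0 < T)
    (hsol : IsClassicalNSSolutionOn (Ico 0 T) ν 0 u p) (hM : ∀ j, 0 < M j)
    (hsub : ∀ j : ℕ,
      Icc (tc j - j * ν / M j ^ 2) (tc j + j * ν / M j ^ 2) ⊆ Ioo (T - T / (j + 1)) T)
    (hval : ∀ s y, Tendsto
      (fun j => ((M j)⁻¹ • stPull (ν / M j ^ 2) (ν / M j) (tc j) (xc j) u) s y) atTop (𝓝 (v s y)))
    {r : ℝ} {z : ℝ × EuclideanSpace ℝ (Fin 3)} {K : ℝ≥0∞}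
    (hK : ∀ᶠ j : ℕ in atTop,
      cknAEss r z ((M j)⁻¹ • stPull (ν / M j ^ 2) (ν / M j) (tc j) (xc j) u) ≤ K) :
    cknAEss r z v ≤ K := by
  rcases le_or_gt r 0 with hr | hr
  · unfold cknAEss
    simp only [Metric.ball_eq_empty.2 hr, Measure.restrict_empty, lintegral_zero_measure, mul_zero]
    exact (essSup_le_of_ae_le 0 (Eventually.of_forall fun _ => le_rfl)).trans bot_le
  have hc : (ENNReal.ofReal r)⁻¹ ≠ ⊤ := ENNReal.inv_ne_top.2 (by simpa using hr)
  have hΦ : Continuous fun x : EuclideanSpace ℝ (Fin 3) => ‖x‖ₑ ^ (2 : ℕ) :=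
    (ENNReal.continuous_pow 2).comp continuous_enorm
  -- pointwise in `t`: the limit slice energy is below the `liminf` of the zooms' slice energies
  set g : ℕ → ℝ → ℝ≥0∞ := fun j t => (ENNReal.ofReal r)⁻¹ * ∫⁻ y in ball z.2 r,
      ‖((M j)⁻¹ • stPull (ν / M j ^ 2) (ν / M j) (tc j) (xc j) u) t y‖ₑ ^ (2 : ℕ) with hg
  have hpt : ∀ t, (ENNReal.ofReal r)⁻¹ * ∫⁻ y in ball z.2 r, ‖v t y‖ₑ ^ (2 : ℕ) ≤
      liminf (fun j => g j t) atTop := fun t => by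
    rw [hg, ENNReal.liminf_const_mul_of_ne_top hc]
    exact mul_le_mul' le_rfl
      (setLIntegral_slice_zoomLimit_le_liminf hν hT hsol hM hsub hval hΦ measurableSet_ball t
        (B := ball z.2 r))
  unfold cknAEss
  calc essSup (fun t => (ENNReal.ofReal r)⁻¹ * ∫⁻ y in ball z.2 r, ‖v t y‖ₑ ^ (2 : ℕ))
        (volume.restrict (Ioo (z.1 - r ^ 2) z.1))
      ≤ essSup (fun t => liminf (fun j => g j t) atTop)
        (volume.restrict (Ioo (z.1 - r ^ 2) z.1)) :=
        essSup_mono_ae (Eventually.of_forall hpt)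
    _ ≤ liminf (fun j => essSup (fun t => g j t) (volume.restrict (Ioo (z.1 - r ^ 2) z.1))) atTop :=
        ENNReal.essSup_liminf_le g
    _ ≤ K := liminf_le_of_frequently_le' (by simpa [hg, cknAEss] using hK.frequently)

end Summit.NavierStokesRegularity.NavierStokesRegularity.Theorems.TypeIliouvilleNoTypeII.TypeIIZoom

end
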